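import Summits.AtomisticToContinuum.HydrodynamicLimit.Theorems.CollisionIsometryCLTMacroClosureStubBlockMGFCochran
import HarnessLib

/-!
# The sub-unit-tilt Gaussian cell MGF (stub `stub_gaussCellMGF`, line `IdeatorTwoGen1Sketch`, crux
# `MacroClosure`, stmt-AtomisticToContinuum-14870), part A: level sets of the block Bregman density

Helper file (`--supports stmt-AtomisticToContinuum-14870`) for the registered stub
`Barycentric.stub_gaussCellMGF`. For `n + 1` i.i.d. `N(u, θ id)` velocities `v : Fin (n+1) → ℝ³` put
`SS = Σ‖vᵢ‖² − ‖Σvᵢ‖²/(n+1)` (sum of squares about the mean), the drift weight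
`W = exp(γ'‖Σvᵢ − (n+1)u‖²/(2θ(n+1)))` (`γ' < 1`) and the block Bregman density
`B = SS/(2θ) − (3(n+1)/2)(1 + log(SS/(3(n+1)θ))) = (3(n+1)/2) ψ(x)`, `ψ(x) = x − 1 − log x`,
`x = SS/(3(n+1)θ)`. We prove the LEVEL-SET BOUND (registered sub-goal `stub_gaussCellMGF_levelset`)

`∫_{t ≤ B⁺} W dN^{⊗(n+1)} ≤ 2 e^{3/2} (1 − γ')^{−3/2} e^{−t·n/(n+1)}`, `t ≥ 0`,

from the landed exact joint Laplace transform `stub_blockMGF_cochran` of `(SS, drift)`: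

* with the drift tilt `κ = −γ'/2` the transform reads `∫ e^{−(λ/θ)SS + c} W = e^c (1+2λ)^{−3n/2}(1−γ')^{−3/2}`
  (`lintegral_tilt_mul_driftWeight`);
* the UNIFIED CHERNOFF BOUND at `1 + 2λ = 1/x₀` (`setLIntegral_driftWeight_chernoff_le`): the
  `W`-mass of `{λ SS ≤ λ·3(n+1)θx₀}` — a cold tail for `x₀ < 1`, a hot tail for `x₀ > 1` — is at most
  `exp(−(3n/2)ψ(x₀) + (3/2)(1 − x₀)) (1−γ')^{−3/2}`;
* `ψ` is strictly decreasing on `(0, 1]`, strictly increasing on `[1, ∞)`, and every level `τ ≥ 0`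
  has a cold root `x₋ ∈ (0, 1]` and a hot root `x₊ ≥ 1` (intermediate value theorem), so that
  `{t ≤ B} ⊆ {SS ≤ 3(n+1)θx₋} ∪ {SS ≥ 3(n+1)θx₊}` with `ψ(x±) = 2t/(3(n+1))` — no Gamma functions and
  no rotation invariance are used.

Part B (`…GaussCellMGF.lean`) slices `e^{γ'B}` along the unit levels of `B` and sums the geometric
series, which converges as soon as `n/(n+1) > γ'`.
-/

noncomputable section

open MeasureTheory Filter Set Topology InformationTheory
open scoped ENNReal ContDiff

namespace Summit.AtomisticToContinuum.HydrodynamicLimit.Theorems.MacroClosureLine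

open Literature.MathematicalPhysics.KineticTheory Literature.Analysis.FluidPDE
open Literature.Analysis.FunctionSpaces

namespace Barycentric

namespace GaussCellMGF

/-! ## Real analysis of `ψ(x) = x − 1 − log x` -/

/-- `ψ(x) = x − 1 − log x` is strictly decreasing on `(0, 1]`. [folklore] -/
theorem psi_lt_of_lt_of_le_one {a b : ℝ} (ha : 0 < a) (hab : a < b) (hb : b ≤ 1) :
    b - 1 - Real.log b < a - 1 - Real.log a := by
  have hb0 : 0 < b := ha.trans hab
  have h1 : Real.log (a / b) < a / b - 1 :=
    Real.log_lt_sub_one_of_pos (div_pos ha hb0) (by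
      rw [Ne, div_eq_one_iff_eq hb0.ne']
      exact hab.ne)
  rw [Real.log_div ha.ne' hb0.ne'] at h1
  have h2 : a / b - 1 ≤ a - b := by
    rw [div_sub_one hb0.ne', div_le_iff₀ hb0]
    nlinarith [mul_nonneg (sub_nonneg.2 hab.le) (sub_nonneg.2 hb)]
  linarith

/-- `ψ(x) = x − 1 − log x` is strictly increasing on `[1, ∞)`. [folklore] -/
theorem psi_lt_of_one_le_of_lt {a b : ℝ} (ha : 1 ≤ a) (hab : a < b) :
    a - 1 - Real.log a < b - 1 - Real.log b := by
  have ha0 : 0 < a := one_pos.trans_le ha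
  have hb0 : 0 < b := ha0.trans hab
  have h1 : Real.log (b / a) < b / a - 1 :=
    Real.log_lt_sub_one_of_pos (div_pos hb0 ha0) (by
      rw [Ne, div_eq_one_iff_eq ha0.ne']
      exact hab.ne')
  rw [Real.log_div hb0.ne' ha0.ne'] at h1
  have h2 : b / a - 1 ≤ b - a := by
    rw [div_sub_one ha0.ne', div_le_iff₀ ha0]
    nlinarith [mul_nonneg (sub_nonneg.2 hab.le) (sub_nonneg.2 ha)]
  linarith

/-- `ψ(x) = x − 1 − log x` is continuous away from `0`. [folklore] -/
theorem continuousOn_psi {s : Set ℝ} (hs : ∀ x ∈ s, 0 < x) :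
    ContinuousOn (fun x => x - 1 - Real.log x) s :=
  (continuousOn_id.sub continuousOn_const).sub
    (Real.continuousOn_log.mono fun x hx => by simpa using (hs x hx).ne')

/-- Every level `τ ≥ 0` of `ψ` is attained on the cold branch `(0, 1]` (intermediate value theorem on
`[e^{−τ−1}, 1]`). [folklore] -/
theorem exists_cold_root {τ : ℝ} (hτ : 0 ≤ τ) : ∃ x : ℝ, 0 < x ∧ x ≤ 1 ∧ x - 1 - Real.log x = τ := by
  set a : ℝ := Real.exp (-(τ + 1)) with ha
  have ha0 : 0 < a := Real.exp_pos _
  have ha1 : a ≤ 1 := by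
    rw [ha, Real.exp_le_one_iff]
    linarith
  have hψa : τ ≤ a - 1 - Real.log a := by
    rw [ha, Real.log_exp]
    linarith [Real.exp_pos (-(τ + 1))]
  have hψ1 : (1 : ℝ) - 1 - Real.log 1 ≤ τ := by simp [hτ]
  obtain ⟨x, ⟨hxa, hx1⟩, hx⟩ := intermediate_value_Icc' ha1
    (continuousOn_psi fun x hx => ha0.trans_le hx.1) ⟨hψ1, hψa⟩
  exact ⟨x, ha0.trans_le hxa, hx1, hx⟩

/-- Every level `τ ≥ 0` of `ψ` is attained on the hot branch `[1, ∞)` (intermediate value theorem on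
`[1, e^{τ+1}]`). [folklore] -/
theorem exists_hot_root {τ : ℝ} (hτ : 0 ≤ τ) : ∃ x : ℝ, 1 ≤ x ∧ x - 1 - Real.log x = τ := by
  set b : ℝ := Real.exp (τ + 1) with hb
  have hb1 : (1 : ℝ) ≤ b := by
    rw [hb, Real.one_le_exp_iff]
    linarith
  have hψb : τ ≤ b - 1 - Real.log b := by
    rw [hb, Real.log_exp]
    nlinarith [Real.quadratic_le_exp_of_nonneg (by linarith : (0 : ℝ) ≤ τ + 1)]
  have hψ1 : (1 : ℝ) - 1 - Real.log 1 ≤ τ := by simp [hτ]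
  obtain ⟨x, ⟨hx1, _⟩, hx⟩ := intermediate_value_Icc hb1
    (continuousOn_psi fun x hx => one_pos.trans_le hx.1) ⟨hψ1, hψb⟩
  exact ⟨x, hx1, hx⟩

/-! ## The drift-tilted block weight and its Chernoff bounds -/

/-- Cochran's joint transform with the drift tilt `κ = −γ'/2` and a constant: for `2λ > −1`,
`∫ e^{−(λ/θ)SS + c} · e^{γ'‖Σv − (n+1)u‖²/(2θ(n+1))} = e^{c}(1+2λ)^{−3n/2}(1−γ')^{−3/2}`. [folklore] -/
theorem lintegral_tilt_mul_driftWeight (γ' : ℝ) (hγ1 : γ' < 1) (n : ℕ) (u : V3) {θ : ℝ} (hθ : 0 < θ)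
    {l : ℝ} (hl : -1 < 2 * l) (c : ℝ) :
    ∫⁻ v, ENNReal.ofReal (Real.exp (-(l / θ) * ((∑ i, ‖v i‖ ^ 2) - ‖∑ i, v i‖ ^ 2 / ((n : ℝ) + 1)) + c)) *
        ENNReal.ofReal (Real.exp (γ' * ‖(∑ i, v i) - ((n : ℝ) + 1) • u‖ ^ 2 / (2 * θ * ((n : ℝ) + 1))))
      ∂(Measure.pi fun _ : Fin (n + 1) => gaussMeasure u θ) =
    ENNReal.ofReal (Real.exp c * (1 + 2 * l) ^ (-(3 : ℝ) / 2 * n) * (1 - γ') ^ (-(3 : ℝ) / 2)) := by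
  have hκ : -1 < 2 * (-γ' / 2) := by linarith
  have h := stub_blockMGF_cochran n u θ hθ l (-γ' / 2) hl hκ
  have hN : ((n : ℝ) + 1) ≠ 0 := by positivity
  have hpt : ∀ v : Fin (n + 1) → V3,
      ENNReal.ofReal (Real.exp (-(l / θ) * ((∑ i, ‖v i‖ ^ 2) - ‖∑ i, v i‖ ^ 2 / ((n : ℝ) + 1)) + c)) *
        ENNReal.ofReal (Real.exp (γ' * ‖(∑ i, v i) - ((n : ℝ) + 1) • u‖ ^ 2 / (2 * θ * ((n : ℝ) + 1)))) =
      ENNReal.ofReal (Real.exp c) * ENNReal.ofReal (Real.exp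
        (-(l / θ) * ((∑ i, ‖v i‖ ^ 2) - ‖∑ i, v i‖ ^ 2 / ((n : ℝ) + 1)) -
          (-γ' / 2) / (θ * ((n : ℝ) + 1)) * ‖(∑ i, v i) - ((n : ℝ) + 1) • u‖ ^ 2)) := by
    intro v
    rw [← ENNReal.ofReal_mul (Real.exp_pos _).le, ← ENNReal.ofReal_mul (Real.exp_pos _).le,
      ← Real.exp_add, ← Real.exp_add]
    congr 2
    field_simp
    ring
  simp_rw [hpt]
  rw [lintegral_const_mul' _ _ ENNReal.ofReal_ne_top, h, ← ENNReal.ofReal_mul (Real.exp_pos _).le]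
  congr 1
  rw [show (1 : ℝ) + 2 * (-γ' / 2) = 1 - γ' by ring]
  ring

/-- The total mass of the drift weight: `∫ e^{γ'‖Σv − (n+1)u‖²/(2θ(n+1))} = (1−γ')^{−3/2}`. [folklore] -/
theorem lintegral_driftWeight (γ' : ℝ) (hγ1 : γ' < 1) (n : ℕ) (u : V3) {θ : ℝ} (hθ : 0 < θ) :
    ∫⁻ v, ENNReal.ofReal (Real.exp (γ' * ‖(∑ i, v i) - ((n : ℝ) + 1) • u‖ ^ 2 / (2 * θ * ((n : ℝ) + 1))))
      ∂(Measure.pi fun _ : Fin (n + 1) => gaussMeasure u θ) =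
    ENNReal.ofReal ((1 - γ') ^ (-(3 : ℝ) / 2)) := by
  have h := lintegral_tilt_mul_driftWeight γ' hγ1 n u hθ (l := 0) (by norm_num) 0
  simp only [zero_div, neg_zero, zero_mul, Real.exp_zero, ENNReal.ofReal_one, one_mul,
    mul_zero, add_zero, Real.one_rpow] at h
  exact h

/-- **Unified Chernoff bound for the drift-tilted block**: for `x₀ > 0` and `λ = (x₀⁻¹ − 1)/2` (cold
tail for `x₀ < 1`, `λ > 0`; hot tail for `x₀ > 1`, `λ < 0`), the drift-weighted mass of
`{λ SS ≤ λ · 3(n+1)θx₀}` is at most `exp(−(3n/2)ψ(x₀) + (3/2)(1 − x₀)) (1−γ')^{−3/2}` — exponential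
Chebyshev against `lintegral_tilt_mul_driftWeight` at `1 + 2λ = 1/x₀`. [folklore] -/
theorem setLIntegral_driftWeight_chernoff_le (γ' : ℝ) (hγ1 : γ' < 1) (n : ℕ) (u : V3) {θ : ℝ}
    (hθ : 0 < θ) {x₀ : ℝ} (hx₀ : 0 < x₀) :
    ∫⁻ v in {v : Fin (n + 1) → V3 |
        (x₀⁻¹ - 1) / 2 * ((∑ i, ‖v i‖ ^ 2) - ‖∑ i, v i‖ ^ 2 / ((n : ℝ) + 1)) ≤
          (x₀⁻¹ - 1) / 2 * (3 * ((n : ℝ) + 1) * θ * x₀)},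
      ENNReal.ofReal (Real.exp (γ' * ‖(∑ i, v i) - ((n : ℝ) + 1) • u‖ ^ 2 / (2 * θ * ((n : ℝ) + 1))))
      ∂(Measure.pi fun _ : Fin (n + 1) => gaussMeasure u θ) ≤
    ENNReal.ofReal (Real.exp (-(3 / 2 * n * (x₀ - 1 - Real.log x₀)) + 3 / 2 * (1 - x₀)) *
      (1 - γ') ^ (-(3 : ℝ) / 2)) := by
  set μ : Measure (Fin (n + 1) → V3) := Measure.pi fun _ : Fin (n + 1) => gaussMeasure u θ with hμ
  set l : ℝ := (x₀⁻¹ - 1) / 2 with hl_def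
  have hl : -1 < 2 * l := by
    rw [hl_def]
    have := inv_pos.2 hx₀
    linarith
  set s₀ : ℝ := 3 * ((n : ℝ) + 1) * θ * x₀ with hs₀
  have hS : MeasurableSet {v : Fin (n + 1) → V3 |
      l * ((∑ i, ‖v i‖ ^ 2) - ‖∑ i, v i‖ ^ 2 / ((n : ℝ) + 1)) ≤ l * s₀} := by
    refine measurableSet_le (Continuous.measurable ?_) measurable_const
    fun_prop
  calc ∫⁻ v in {v : Fin (n + 1) → V3 | l * ((∑ i, ‖v i‖ ^ 2) - ‖∑ i, v i‖ ^ 2 / ((n : ℝ) + 1)) ≤ l * s₀},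
        ENNReal.ofReal (Real.exp (γ' * ‖(∑ i, v i) - ((n : ℝ) + 1) • u‖ ^ 2 / (2 * θ * ((n : ℝ) + 1)))) ∂μ
      ≤ ∫⁻ v in {v : Fin (n + 1) → V3 | l * ((∑ i, ‖v i‖ ^ 2) - ‖∑ i, v i‖ ^ 2 / ((n : ℝ) + 1)) ≤ l * s₀},
        ENNReal.ofReal (Real.exp (-(l / θ) * ((∑ i, ‖v i‖ ^ 2) - ‖∑ i, v i‖ ^ 2 / ((n : ℝ) + 1)) +
            l * s₀ / θ)) *
          ENNReal.ofReal (Real.exp (γ' * ‖(∑ i, v i) - ((n : ℝ) + 1) • u‖ ^ 2 / (2 * θ * ((n : ℝ) + 1))))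
          ∂μ := by
        refine setLIntegral_mono' hS fun v hv => ?_
        simp only [Set.mem_setOf_eq] at hv
        refine le_mul_of_one_le_left' ?_
        rw [ENNReal.one_le_ofReal]
        refine Real.one_le_exp ?_
        have e : -(l / θ) * ((∑ i, ‖v i‖ ^ 2) - ‖∑ i, v i‖ ^ 2 / ((n : ℝ) + 1)) + l * s₀ / θ =
            (l * s₀ - l * ((∑ i, ‖v i‖ ^ 2) - ‖∑ i, v i‖ ^ 2 / ((n : ℝ) + 1))) / θ := by ring
        rw [e]
        exact div_nonneg (by linarith) hθ.le
    _ ≤ ∫⁻ v, ENNReal.ofReal (Real.exp (-(l / θ) * ((∑ i, ‖v i‖ ^ 2) - ‖∑ i, v i‖ ^ 2 / ((n : ℝ) + 1)) +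
            l * s₀ / θ)) *
          ENNReal.ofReal (Real.exp (γ' * ‖(∑ i, v i) - ((n : ℝ) + 1) • u‖ ^ 2 / (2 * θ * ((n : ℝ) + 1))))
          ∂μ := setLIntegral_le_lintegral _ _
    _ = ENNReal.ofReal (Real.exp (l * s₀ / θ) * (1 + 2 * l) ^ (-(3 : ℝ) / 2 * n) *
          (1 - γ') ^ (-(3 : ℝ) / 2)) := lintegral_tilt_mul_driftWeight γ' hγ1 n u hθ hl _
    _ = ENNReal.ofReal (Real.exp (-(3 / 2 * n * (x₀ - 1 - Real.log x₀)) + 3 / 2 * (1 - x₀)) *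
          (1 - γ') ^ (-(3 : ℝ) / 2)) := by
        congr 2
        have h1 : 1 + 2 * l = x₀⁻¹ := by rw [hl_def]; ring
        have hc : l * s₀ / θ = 3 / 2 * ((n : ℝ) + 1) * (1 - x₀) := by
          rw [hs₀, hl_def]
          field_simp
        rw [h1, Real.rpow_def_of_pos (inv_pos.2 hx₀), Real.log_inv, ← Real.exp_add, hc]
        congr 1
        ring

/-- **Level sets of the block Bregman density carry exponentially small drift-weighted mass**:
for `t ≥ 0`, with `B = SS/(2θ) − (3(n+1)/2)(1 + log(SS/(3(n+1)θ)))`,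
`∫_{t ≤ B⁺} e^{γ'‖Σv − (n+1)u‖²/(2θ(n+1))} ≤ 2e^{3/2}(1−γ')^{−3/2} e^{−t·n/(n+1)}` — the level set
lies in a cold tail `{SS ≤ 3(n+1)θx₋}` and a hot tail `{SS ≥ 3(n+1)θx₊}` (`ψ(x±) = 2t/(3(n+1))`),
each priced by the unified Chernoff bound. [folklore] -/
theorem setLIntegral_driftWeight_levelset_le (γ' : ℝ) (hγ1 : γ' < 1) (n : ℕ) (u : V3) {θ : ℝ}
    (hθ : 0 < θ) {t : ℝ} (ht : 0 ≤ t) :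
    ∫⁻ v in {v : Fin (n + 1) → V3 | t ≤ max
        (((∑ i, ‖v i‖ ^ 2) - ‖∑ i, v i‖ ^ 2 / ((n : ℝ) + 1)) / (2 * θ) -
          3 * ((n : ℝ) + 1) / 2 * (1 + Real.log (((∑ i, ‖v i‖ ^ 2) - ‖∑ i, v i‖ ^ 2 / ((n : ℝ) + 1)) /
            (3 * ((n : ℝ) + 1) * θ)))) 0},
      ENNReal.ofReal (Real.exp (γ' * ‖(∑ i, v i) - ((n : ℝ) + 1) • u‖ ^ 2 / (2 * θ * ((n : ℝ) + 1))))
      ∂(Measure.pi fun _ : Fin (n + 1) => gaussMeasure u θ) ≤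
    ENNReal.ofReal (2 * Real.exp (3 / 2) * (1 - γ') ^ (-(3 : ℝ) / 2) *
      Real.exp (-(t * (n / ((n : ℝ) + 1))))) := by
  set μ : Measure (Fin (n + 1) → V3) := Measure.pi fun _ : Fin (n + 1) => gaussMeasure u θ with hμ
  have hN0 : (0 : ℝ) < (n : ℝ) + 1 := by positivity
  have hD : 0 ≤ (1 - γ') ^ (-(3 : ℝ) / 2) := Real.rpow_nonneg (by linarith) _
  rcases ht.eq_or_lt with rfl | ht0
  · calc _ ≤ ∫⁻ v, ENNReal.ofReal (Real.exp (γ' * ‖(∑ i, v i) - ((n : ℝ) + 1) • u‖ ^ 2 /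
            (2 * θ * ((n : ℝ) + 1)))) ∂μ := setLIntegral_le_lintegral _ _
      _ = ENNReal.ofReal ((1 - γ') ^ (-(3 : ℝ) / 2)) := lintegral_driftWeight γ' hγ1 n u hθ
      _ ≤ _ := by
          refine ENNReal.ofReal_le_ofReal ?_
          rw [zero_mul, neg_zero, Real.exp_zero, mul_one]
          nlinarith [Real.add_one_le_exp (3 / 2 : ℝ)]
  -- `t > 0`: the two roots of `ψ = τ`
  set τ : ℝ := 2 * t / (3 * ((n : ℝ) + 1)) with hτ
  have hτ0 : 0 < τ := by positivity
  obtain ⟨xm, hxm0, hxm1, hψm⟩ := exists_cold_root hτ0.le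
  obtain ⟨xp, hxp1, hψp⟩ := exists_hot_root hτ0.le
  have hxm1' : xm < 1 := lt_of_le_of_ne hxm1 fun h => by
    rw [h, Real.log_one] at hψm
    linarith
  have hxp1' : 1 < xp := lt_of_le_of_ne hxp1 fun h => by
    rw [← h, Real.log_one] at hψp
    linarith
  have hxp0 : 0 < xp := one_pos.trans hxp1'
  have hlm : 0 < (xm⁻¹ - 1) / 2 := by
    have : 1 < xm⁻¹ := (one_lt_inv₀ hxm0).2 hxm1'
    linarith
  have hlp : (xp⁻¹ - 1) / 2 < 0 := by
    have : xp⁻¹ < 1 := inv_lt_one_of_one_lt₀ hxp1'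
    linarith
  -- the level set lies in the union of the cold and the hot tail
  have hcover : {v : Fin (n + 1) → V3 | t ≤ max
        (((∑ i, ‖v i‖ ^ 2) - ‖∑ i, v i‖ ^ 2 / ((n : ℝ) + 1)) / (2 * θ) -
          3 * ((n : ℝ) + 1) / 2 * (1 + Real.log (((∑ i, ‖v i‖ ^ 2) - ‖∑ i, v i‖ ^ 2 / ((n : ℝ) + 1)) /
            (3 * ((n : ℝ) + 1) * θ)))) 0} ⊆
      {v : Fin (n + 1) → V3 | (xm⁻¹ - 1) / 2 * ((∑ i, ‖v i‖ ^ 2) - ‖∑ i, v i‖ ^ 2 / ((n : ℝ) + 1)) ≤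
          (xm⁻¹ - 1) / 2 * (3 * ((n : ℝ) + 1) * θ * xm)} ∪
      {v : Fin (n + 1) → V3 | (xp⁻¹ - 1) / 2 * ((∑ i, ‖v i‖ ^ 2) - ‖∑ i, v i‖ ^ 2 / ((n : ℝ) + 1)) ≤
          (xp⁻¹ - 1) / 2 * (3 * ((n : ℝ) + 1) * θ * xp)} := by
    intro v hv
    simp only [Set.mem_setOf_eq, Set.mem_union] at hv ⊢
    set S : ℝ := (∑ i, ‖v i‖ ^ 2) - ‖∑ i, v i‖ ^ 2 / ((n : ℝ) + 1) with hS
    rcases le_or_gt S (3 * ((n : ℝ) + 1) * θ * xm) with h | h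
    · exact Or.inl (mul_le_mul_of_nonneg_left h hlm.le)
    · right
      have hs0 : 0 < 3 * ((n : ℝ) + 1) * θ * xm := by positivity
      have htB : t ≤ S / (2 * θ) - 3 * ((n : ℝ) + 1) / 2 *
          (1 + Real.log (S / (3 * ((n : ℝ) + 1) * θ))) := by
        rcases le_max_iff.1 hv with h' | h'
        · exact h'
        · exact absurd h' (not_le.2 ht0)
      set x : ℝ := S / (3 * ((n : ℝ) + 1) * θ) with hx
      have hS2 : S / (2 * θ) = 3 * ((n : ℝ) + 1) / 2 * x := by
        rw [hx]
        field_simp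
      have hτx : τ ≤ x - 1 - Real.log x := by
        rw [hS2] at htB
        rw [hτ, div_le_iff₀ (by positivity)]
        nlinarith
      have hxm_lt : xm < x := by
        rw [hx, lt_div_iff₀ (by positivity)]
        linarith
      rcases le_or_gt x 1 with hx1 | hx1
      · have := psi_lt_of_lt_of_le_one hxm0 hxm_lt hx1
        linarith
      · have hxp_le : xp ≤ x := by
          by_contra hcon
          have := psi_lt_of_one_le_of_lt hx1.le (not_le.1 hcon)
          linarith
        have hSge : 3 * ((n : ℝ) + 1) * θ * xp ≤ S := by
          rw [hx, le_div_iff₀ (by positivity)] at hxp_le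
          linarith
        exact mul_le_mul_of_nonpos_left hSge hlp.le
  have hτn : -(3 / 2 * n * τ) = -(t * (n / ((n : ℝ) + 1))) := by
    rw [hτ]
    field_simp
  calc _ ≤ _ := lintegral_mono_set hcover
    _ ≤ _ := lintegral_union_le _ _ _
    _ ≤ _ := add_le_add (setLIntegral_driftWeight_chernoff_le γ' hγ1 n u hθ hxm0)
        (setLIntegral_driftWeight_chernoff_le γ' hγ1 n u hθ hxp0)
    _ ≤ _ := by
        rw [← ENNReal.ofReal_add (by positivity) (by positivity), hψm, hψp, hτn]
        refine ENNReal.ofReal_le_ofReal ?_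
        have e1 : Real.exp (-(t * (n / ((n : ℝ) + 1))) + 3 / 2 * (1 - xm)) ≤
            Real.exp (3 / 2) * Real.exp (-(t * (n / ((n : ℝ) + 1)))) := by
          rw [← Real.exp_add]
          exact Real.exp_le_exp.2 (by nlinarith)
        have e2 : Real.exp (-(t * (n / ((n : ℝ) + 1))) + 3 / 2 * (1 - xp)) ≤
            Real.exp (3 / 2) * Real.exp (-(t * (n / ((n : ℝ) + 1)))) := by
          rw [← Real.exp_add]
          exact Real.exp_le_exp.2 (by nlinarith)
        nlinarith [mul_le_mul_of_nonneg_right e1 hD, mul_le_mul_of_nonneg_right e2 hD]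

end GaussCellMGF

/-- **`stub_gaussCellMGF_levelset`** (registered sub-goal of `stub_gaussCellMGF`): for `n + 1` i.i.d.
`N(u, θ id)` velocities, `γ' < 1` and `t ≥ 0`, the drift-weighted mass of the level set `{t ≤ B⁺}` of
the block Bregman density `B = SS/(2θ) − (3(n+1)/2)(1 + log(SS/(3(n+1)θ)))`
(`SS = Σ‖vᵢ‖² − ‖Σvᵢ‖²/(n+1)`, drift weight `e^{γ'‖Σvᵢ − (n+1)u‖²/(2θ(n+1))}`) is at most
`2e^{3/2}(1−γ')^{−3/2} e^{−t·n/(n+1)}` — Cochran's joint transform, one cold and one hot Chernoff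
bound. [folklore] -/
theorem stub_gaussCellMGF_levelset : ∀ γ' : ℝ, γ' < 1 → ∀ (n : ℕ) (u : V3) (θ : ℝ), 0 < θ → ∀ t : ℝ, 0 ≤ t → ∫⁻ v in {v : Fin (n + 1) → V3 | t ≤ max (((∑ i, ‖v i‖ ^ 2) - ‖∑ i, v i‖ ^ 2 / ((n : ℝ) + 1)) / (2 * θ) - 3 * ((n : ℝ) + 1) / 2 * (1 + Real.log (((∑ i, ‖v i‖ ^ 2) - ‖∑ i, v i‖ ^ 2 / ((n : ℝ) + 1)) / (3 * ((n : ℝ) + 1) * θ)))) 0}, ENNReal.ofReal (Real.exp (γ' * ‖(∑ i, v i) - ((n : ℝ) + 1) • u‖ ^ 2 / (2 * θ * ((n : ℝ) + 1)))) ∂(Measure.pi fun _ : Fin (n + 1) => gaussMeasure u θ) ≤ ENNReal.ofReal (2 * Real.exp (3 / 2) * (1 - γ') ^ (-(3 : ℝ) / 2) * Real.exp (-(t * (n / ((n : ℝ) + 1))))) :=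
  fun γ' hγ1 n u _ hθ _ ht => GaussCellMGF.setLIntegral_driftWeight_levelset_le γ' hγ1 n u hθ ht

end Barycentric

end Summit.AtomisticToContinuum.HydrodynamicLimit.Theorems.MacroClosureLine

end
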